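import Summits.Ventures.PercRepro.ProfilePointedCircuitClassesStarSharpRegimes

/-!
# PercRepro — THE PENCIL OF CASE D0, PART A: `b` ON THE LINE `ef`
(p5, gen 55; `proofs/P5-GM1.md` §82 ADD 10)

The pencil regime: `b` is generic in `N ／ b′` and some line through `e` is ON.  Part A treats the sub-case in which
the ON line through `e` is the line `ef` (`ρ{e, f, b, b′} = 3`).  Then a set containing `e` is ON iff `f` lies in its
closure (`on_iff_of_line_ef`), every ON demand has `¬c1`, its swap is ON whenever it is bi-independent, so the bad
demands are defects of `R`, and every C-target is ON: the generic count of the loop regime applies verbatim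
(`inCount_thru_le_of_pencil_f`).
-/

open scoped Matroid

namespace PercRepro.Cogirth

open Finset ThmH Skew Shadow Profile

open Classical

variable {α : Type} [DecidableEq α] {N : Matroid α} [N.Finite]

section StarSharpPencilA

variable {b b' : α}

/-- ON is inherited by sets whose closure contains an ON set: if `S₀` is ON and `S₀ ⊆ cl(S)` then `S` is ON. -/
theorem on_of_on_subset_cl (h : SeriesPair N b b') {S S₀ : Finset α} (hS : S ⊆ ((gr N).erase b).erase b')
    (hS₀ : rk N (insert b (insert b' S₀)) = rk N S₀ + 1) (hcl : rk N (S ∪ S₀) = rk N S) :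
    rk N (insert b (insert b' S)) = rk N S + 1 := by
  have h1 := rk_insert_bb'_bounds h hS
  have h2 := rk_union_add_rk_le_of_subset_inter' (N := N) (S := S ∪ S₀) (T := insert b (insert b' S₀)) (I := S₀)
    (subset_inter subset_union_right ((subset_insert _ _).trans (subset_insert _ _)))
  have h3 : rk N (insert b (insert b' S)) ≤ rk N (S ∪ S₀ ∪ insert b (insert b' S₀)) := by
    apply rk_mono'
    intro u hu
    rw [mem_insert, mem_insert] at hu
    rcases hu with rfl | rfl | hu
    · exact mem_union_right _ (mem_insert_self _ _)
    · exact mem_union_right _ (mem_insert_of_mem (mem_insert_self _ _))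
    · exact mem_union_left _ (mem_union_left _ hu)
  rw [hcl, hS₀] at h2
  omega

/-- **THE LINE `ef` IS ON**: a set `S ∋ e` is ON iff `f ∈ cl(S)`. -/
theorem on_iff_of_line_ef (h : SeriesPair N b b') {e f : α} (he : e ∈ gr N) (hf : f ∈ gr N) (hfb : f ≠ b)
    (hfb' : f ≠ b') (hefon : rk N (insert b (insert b' {e, f})) = 3) (hef2 : rk N {e, f} = 2)
    (heb3 : rk N {e, b, b'} = 3) {S : Finset α} (hS : S ⊆ ((gr N).erase b).erase b') (heS : e ∈ S) :
    rk N (insert b (insert b' S)) = rk N S + 1 ↔ rk N (insert f S) = rk N S := by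
  have hfE : f ∈ ((gr N).erase b).erase b' := mem_erase.2 ⟨hfb', mem_erase.2 ⟨hfb, hf⟩⟩
  have hSg : S ⊆ gr N := hS.trans ((erase_subset _ _).trans (erase_subset _ _))
  constructor
  · intro hon
    -- `f ∈ cl{e, b, b′} ⊆ cl(S + b + b′)`, so `(S + f) + b + b′` has rank `ρS + 1 ≥ ρ(S + f) + 1`
    have h1 : rk N (insert f {e, b, b'}) = rk N {e, b, b'} := by
      have h2 : insert f ({e, b, b'} : Finset α) = insert b (insert b' {e, f}) := by
        ext u; simp only [mem_insert, mem_singleton]; tauto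
      rw [h2, hefon, heb3]
    have h3 := rk_insert_eq_of_rk_insert_eq_subset' (N := N) (S := {e, b, b'}) (S' := insert b (insert b' S)) (w := f)
      (by
        intro u hu; simp only [mem_insert, mem_singleton] at hu
        rcases hu with rfl | rfl | rfl
        · exact mem_insert_of_mem (mem_insert_of_mem heS)
        · exact mem_insert_self _ _
        · exact mem_insert_of_mem (mem_insert_self _ _)) h1
    have h4 : insert f (insert b (insert b' S)) = insert b (insert b' (insert f S)) := by
      ext u; simp only [mem_insert]; tauto
    rw [h4, hon] at h3
    have h5 := rk_insert_bb'_bounds h (insert_subset hfE hS)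
    have h6 : rk N S ≤ rk N (insert f S) := rk_mono' (subset_insert _ _)
    omega
  · intro hcl
    apply on_of_on_subset_cl h hS (S₀ := {e, f}) (by rw [hefon, hef2])
    have h1 : S ∪ {e, f} = insert f S := by
      ext u; simp only [mem_union, mem_insert, mem_singleton]
      constructor
      · rintro (hu | rfl | rfl)
        · exact Or.inr hu
        · exact Or.inr heS
        · exact Or.inl rfl
      · rintro (rfl | hu)
        · exact Or.inr (Or.inr rfl)
        · exact Or.inl hu
    rw [h1, hcl]

/-- **THE PENCIL, `b` ON THE LINE `ef`**: the `b′`-avoiding inequality when `ρ{e, f, b, b′} = 3` and `b ∦ e`. -/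
theorem inCount_thru_le_of_pencil_f (hn : (gr N).card = 9) (h : SeriesPair N b b')
    {e f : α} (he : e ∈ gr N) (hf : f ∈ gr N) (hef : e ≠ f) (heb : e ≠ b) (heb' : e ≠ b') (hfb : f ≠ b) (hfb' : f ≠ b')
    (he1 : ∀ y ∈ ((((gr N).erase b).erase b').erase f).erase e, rk N {e, y} = 2)
    (hf1 : ∀ y ∈ ((((gr N).erase b).erase b').erase f).erase e, rk N {f, y} = 2)
    (hfc : ∀ y ∈ ((((gr N).erase b).erase b').erase f).erase e, rk N (((((gr N).erase b).erase b').erase f).erase y) = 4)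
    (hX : rk N (((((gr N).erase b).erase b').erase f).erase e) = 4) (hef2 : rk N {e, f} = 2)
    (hefon : rk N (insert b (insert b' {e, f})) = 3) (heb3 : rk N {e, b, b'} = 3) :
    inCount N 4 e + thruCount N 4 {b', f} + thruCount N 4 {b', e, f} ≤
      inCount N 4 f + thruCount N 4 {e, f} + thruCount N 4 {b', e} := by
  have hfE : f ∈ ((gr N).erase b).erase b' := mem_erase.2 ⟨hfb', mem_erase.2 ⟨hfb, hf⟩⟩
  have heE : e ∈ ((gr N).erase b).erase b' := mem_erase.2 ⟨heb', mem_erase.2 ⟨heb, he⟩⟩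
  have hXE : ((((gr N).erase b).erase b').erase f).erase e ⊆ ((gr N).erase b).erase b' :=
    (erase_subset _ _).trans (erase_subset _ _)
  have hXg : ((((gr N).erase b).erase b').erase f).erase e ⊆ gr N :=
    hXE.trans ((erase_subset _ _).trans (erase_subset _ _))
  have hbb' : b ≠ b' := h.2.2.1
  have hdata := d0_demand_data h hn hf hef heb hfb hfb' (e := e)
  -- every bad demand is a defect of `R`
  have hP : ∀ W ∈ (d0DON N b' e f).filter (fun W => ¬ d0c0 N b b' e f W ∧ ¬ (d0c1 N b e f W ∧ d0c2 N b b' e f W)),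
      ¬ (rk N (insert f ((W.erase b).erase e)) = 3 ∧
        rk N (insert e (((((gr N).erase b).erase b').erase f).erase e \ (W.erase b).erase e)) = 4) := by
    intro W hW hswap
    have hW' := mem_filter.1 hW
    have hWd := hW'.1
    simp only [d0DON, mem_filter] at hWd
    obtain ⟨-, hπX, -, -, -, hπe, -, hon⟩ := hdata W hWd.1 hWd.2.1 hWd.2.2
    have hfcl : rk N (insert f (insert e ((W.erase b).erase e))) = rk N (insert e ((W.erase b).erase e)) :=
      (on_iff_of_line_ef h he hf hfb hfb' hefon hef2 heb3 (insert_subset heE (hπX.trans hXE))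
        (mem_insert_self _ _)).1 (by rw [hπe]; exact hon)
    apply hW'.2.1
    refine ⟨hswap.1, hswap.2, ?_⟩
    have hswon := on_of_on_subset_cl h (insert_subset hfE (hπX.trans hXE)) (S₀ := {e, f}) (by rw [hefon, hef2]) (by
      have h1 : insert f ((W.erase b).erase e) ∪ {e, f} = insert f (insert e ((W.erase b).erase e)) := by
        ext u; simp only [mem_union, mem_insert, mem_singleton]
        constructor
        · rintro ((rfl | hu) | rfl | rfl)
          · exact Or.inl rfl
          · exact Or.inr (Or.inr hu)
          · exact Or.inr (Or.inl rfl)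
          · exact Or.inl rfl
        · rintro (rfl | rfl | hu)
          · exact Or.inl (Or.inl rfl)
          · exact Or.inr (Or.inl rfl)
          · exact Or.inl (Or.inr hu)
      rw [h1, hfcl, hπe, hswap.1])
    rw [hswap.1] at hswon
    exact hswon
  -- every C-point gives an ON target
  have htgt : ∀ x ∈ ((((gr N).erase b).erase b').erase f).erase e, rk N {e, f, x} = 3 →
      rk N ((((((gr N).erase b).erase b').erase f).erase e).erase x) = 4 →
      insert b {e, f, x} ∈ (biIndepSets N 4).filter (fun W => (f ∈ W ∧ b' ∉ W) ∧
        (e ∈ W ∧ b ∈ W ∧ ¬ (gr N \ W).erase b' ∈ biIndepSets N 4)) := by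
    intro x hx hefx hx4
    have hS : ({e, f, x} : Finset α) ⊆ ((gr N).erase b).erase b' := by
      intro w hw; simp only [mem_insert, mem_singleton] at hw
      rcases hw with rfl | rfl | rfl
      · exact heE
      · exact hfE
      · exact hXE hx
    have hS3' : ({e, f, x} : Finset α).card = 3 := by
      have hxe : x ≠ e := (mem_erase.1 hx).1
      have hxf : x ≠ f := (mem_erase.1 (mem_erase.1 hx).2).1
      rw [card_insert_of_notMem, card_pair hxf.symm]
      simp only [mem_insert, mem_singleton, not_or]; exact ⟨hef, hxe.symm⟩
    simp only [mem_filter]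
    refine ⟨?_, ⟨mem_insert_of_mem (mem_insert_of_mem (mem_insert_self _ _)), ?_⟩,
      mem_insert_of_mem (mem_insert_self _ _), mem_insert_self _ _, ?_⟩
    · rw [insert_b_mem_biIndepSets_iff h hn hS hS3', E7_sdiff_efx_eq]
      exact ⟨hefx, hx4⟩
    · intro h'
      simp only [mem_insert, mem_singleton] at h'
      rcases h' with h2 | h2 | h2 | h2
      · exact hbb' h2.symm
      · exact heb' h2.symm
      · exact hfb' h2.symm
      · exact (mem_erase.1 (hXE hx)).1 h2.symm
    · rw [off_image_efx_iff h hn he hf hef heb heb' hfb hfb' hx]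
      rintro ⟨-, h5⟩
      have hon := on_of_on_subset_cl h hS (S₀ := {e, f}) (by rw [hefon, hef2]) (by
        rw [union_eq_left.2 (by
          intro u hu; simp only [mem_insert, mem_singleton] at hu
          rcases hu with rfl | rfl
          · exact mem_insert_self _ _
          · exact mem_insert_of_mem (mem_insert_self _ _))])
      rw [hefx] at hon
      omega
  -- THE ASSEMBLY (as in D0R)
  rw [inCount_thru_split']
  have hsplit := card_filter_add_card_filter_not (s := (biIndepSets N 4).filter (fun W => (e ∈ W ∧ f ∉ W) ∧ b' ∉ W))
    (fun W => (gr N \ W).erase b' ∈ biIndepSets N 4)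
  simp only [filter_filter] at hsplit
  have htar : ((biIndepSets N 4).filter (fun W => (f ∈ W ∧ b' ∉ W) ∧ (e ∉ W ∧ (gr N \ W).erase b' ∈ biIndepSets N 4))).card +
      ((biIndepSets N 4).filter (fun W => (f ∈ W ∧ b' ∉ W) ∧ (e ∉ W ∧ b ∈ W ∧ ¬ (gr N \ W).erase b' ∈ biIndepSets N 4))).card +
      ((biIndepSets N 4).filter (fun W => (f ∈ W ∧ b' ∉ W) ∧ (e ∈ W ∧ b ∉ W))).card +
      ((biIndepSets N 4).filter (fun W => (f ∈ W ∧ b' ∉ W) ∧ (e ∈ W ∧ b ∈ W ∧ ¬ (gr N \ W).erase b' ∈ biIndepSets N 4))).card ≤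
      ((biIndepSets N 4).filter (fun W => f ∈ W ∧ b' ∉ W)).card := by
    rw [← card_union_of_disjoint, ← card_union_of_disjoint, ← card_union_of_disjoint]
    · apply card_le_card
      intro W hW
      simp only [mem_union, mem_filter] at hW ⊢
      rcases hW with ((hW | hW) | hW) | hW <;> exact ⟨hW.1, hW.2.1⟩
    · rw [disjoint_union_left, disjoint_union_left]
      refine ⟨⟨?_, ?_⟩, ?_⟩ <;> rw [disjoint_filter]
      · rintro W _ ⟨-, heW, -⟩ ⟨-, heW', -, -⟩; exact heW heW'
      · rintro W _ ⟨-, heW, -, -⟩ ⟨-, heW', -, -⟩; exact heW heW'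
      · rintro W _ ⟨-, -, hbW⟩ ⟨-, -, hbW', -⟩; exact hbW hbW'
    · rw [disjoint_union_left]
      refine ⟨?_, ?_⟩ <;> rw [disjoint_filter]
      · rintro W _ ⟨-, heW, -⟩ ⟨-, heW', -⟩; exact heW heW'
      · rintro W _ ⟨-, heW, -, -⟩ ⟨-, heW', -⟩; exact heW heW'
    · rw [disjoint_filter]
      rintro W _ ⟨-, -, hc⟩ ⟨-, -, -, hc'⟩; exact hc' hc
  have hinj1 := card_off_demands_le (N := N) (b' := b') (e := e) hf hfb'
  have hs1 := card_filter_add_card_filter_not (s := d0DON N b' e f) (fun W => d0c0 N b b' e f W)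
  have hs2 := card_filter_add_card_filter_not (s := (d0DON N b' e f).filter (fun W => ¬ d0c0 N b b' e f W))
    (fun W => d0c1 N b e f W ∧ d0c2 N b b' e f W)
  simp only [filter_filter] at hs2
  have hshape : (d0DON N b' e f).filter (fun W => ¬ d0c0 N b b' e f W ∧ (d0c1 N b e f W ∧ d0c2 N b b' e f W)) =
      (d0DON N b' e f).filter (fun W => (¬ d0c0 N b b' e f W ∧ d0c1 N b e f W) ∧ d0c2 N b b' e f W) :=
    filter_congr (fun W _ => and_assoc.symm)
  rw [hshape] at hs2
  have hinjR0 := d0_injR0 h hn he hf hef heb heb' hfb hfb'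
  have hinjR2 := d0_injR2'' hn h he hf hef heb heb' hfb hfb'
  have hsB := card_filter_add_card_filter_not
    (s := (biIndepSets N 4).filter (fun W => (f ∈ W ∧ b' ∉ W) ∧ (e ∈ W ∧ b ∉ W)))
    (fun B => insert b (B.erase f) ∈ biIndepSets N 4 ∧ rk N (insert b (insert b' (B.erase f))) = 4)
  simp only [filter_filter] at hsB
  have hDON : (d0DON N b' e f).card = ((biIndepSets N 4).filter (fun W => ((e ∈ W ∧ f ∉ W) ∧ b' ∉ W) ∧
      ¬ (gr N \ W).erase b' ∈ biIndepSets N 4)).card := rfl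
  rw [← hDON] at hsplit
  -- THE BAD DEMANDS: the generic count
  have hbad : ((d0DON N b' e f).filter (fun W => ¬ d0c0 N b b' e f W ∧ ¬ (d0c1 N b e f W ∧ d0c2 N b b' e f W))).card ≤
      ((biIndepSets N 4).filter (fun W => (f ∈ W ∧ b' ∉ W) ∧
        (e ∈ W ∧ b ∈ W ∧ ¬ (gr N \ W).erase b' ∈ biIndepSets N 4))).card := by
    apply card_bad_le_targets_of_card_le_three_P hn h he hf hef heb heb' hfb hfb' he1 hf1 hfc hX hef2
      (P := fun W => ¬ d0c0 N b b' e f W ∧ ¬ (d0c1 N b e f W ∧ d0c2 N b b' e f W)) hP htgt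
    apply card_le_three_of_no_four
    intro W₁ h1 W₂ h2 W₃ h3 W₄ h4
    simp only [mem_filter] at h1 h2 h3 h4
    exact hthree_of_defects hn h he hf hef heb heb' hfb hfb' he1 hf1 hfc hX W₁ h1.1 W₂ h2.1 W₃ h3.1 W₄ h4.1
      (hP W₁ (mem_filter.2 h1)) (hP W₂ (mem_filter.2 h2)) (hP W₃ (mem_filter.2 h3)) (hP W₄ (mem_filter.2 h4))
  have hs2' : ((d0DON N b' e f).filter (fun W => (¬ d0c0 N b b' e f W ∧ d0c1 N b e f W) ∧ d0c2 N b b' e f W)).card +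
      ((d0DON N b' e f).filter (fun W => ¬ d0c0 N b b' e f W ∧ ¬ (d0c1 N b e f W ∧ d0c2 N b b' e f W))).card =
      ((d0DON N b' e f).filter (fun W => ¬ d0c0 N b b' e f W)).card := by
    rw [← hs2]
  have hsum := Nat.add_le_add hinjR0 (Nat.add_le_add hinjR2 hbad)
  omega

end StarSharpPencilA

end PercRepro.Cogirth
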